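import Summits.QuantumFields.YangMills.Theorems.BalabanUVNodesN18CombStepC0Letters
import Summits.QuantumFields.YangMills.Theorems.BalabanUVNodesN18CombStepC1Sum
import Summits.QuantumFields.YangMills.Theorems.BalabanUVNodesN18TransportLettersAssembly
import HarnessLib

/-!
# N18 (β)-transport letters: THE C¹ LETTER OF THE COMB GENERATOR OF RECORD AT THE TABLE (coefficient one on `α₁(k+1,j+1)`)

[DAGN18W3-G5 INTENT-4, file (4e)] — count-neutral helper toward K3⁸ `stmt-QuantumFields-27366` (K3⁷ `stmt-QuantumFields-20544` aside; NOT claimed, NOT closed).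
YM mass gap (Clay) NOT proved by any of this; R4 closes the conditional finite-𝕋⁴ rung `BalabanLadder.UV` only.

WHAT.  (3a) p633326 `comb_letters_TΦOfRecord` exhibits the comb generator of record `l` with its C⁰ letters and a CRUDE C¹ bound `2S₀∕η_j`.  This file re-exports the same `l`
with the SHARP C¹ letter of (4d) `norm_nabla_transported_comb_le` read at the record: per table point `(j, Y)` and run-B data `Factors ∕ CondI ∕ CondII`, for every direction pair
`q = (x, ν, μ)` of run A's frame over `Y`,
`‖∇^ξ_{U_A,ν}(A′_A − i∇^ξ_{U_A}l)(·, μ)(x)‖ ≤ S₁ := ξ⁻¹·[(η∕ξ)·L·(69ℓ·t·α₁B + L·(η·α₁B + 2t·α₁B)) + 2·(R∕ξ + (η∕ξ)·69ℓ²·t·α₁B)]`, `ξ = η_j`, `η = η_{j+1}`, `ξ = Lη`: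
the coefficient of `α₁B = α₁(k+1,j+1)` is `L²η²∕ξ² = 1`; `2R∕ξ²` is the one term without `η`-decay (numbers in (4d)'s header).  Displayed numerics: `ηα₁B ≤ 1∕4`,
`((d+4)L∕2)·α₀Bη² ≤ t`, `136ℓ((2ηα₁B + t + 2ηα₁B·t) + t) ≤ 1`.
* ★★★ `comb_letters_C1_TΦOfRecord` ((3a)'s `nabla_fieldShift_comp` for the ladder identification) (∃ l: (3a)'s letters (0)–(4) + the sharp (5)).

0 `def`, 0 `sorry`.  References: T. Bałaban, CMP **98** (1985) [Balaban1985Averaging] (Prop. 3 (122)–(126) p.36, (62)–(63) p.28); CMP **109** (1987) [Balaban1987RG1]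
((0.4) p.253, (0.24)–(0.25) p.257, (1.10)–(1.16) p.262).
-/

noncomputable section

open scoped BigOperators Matrix.Norms.L2Operator
open NormedSpace

namespace YMDAG.N18.TransportOfRecord

open Complex (I)
open Literature.MathematicalPhysics.QuantumFieldTheory.Balaban1983to89
open Literature.MathematicalPhysics.QuantumFieldTheory.Balaban1983to89.T4Continuum
open Literature.MathematicalPhysics.QuantumFieldTheory.Balaban1983to89.T4LevelShift
open Literature.MathematicalPhysics.QuantumFieldTheory.Balaban1983to89.BlockAveraging
open Literature.MathematicalPhysics.QuantumFieldTheory.Balaban1983to89.BlockAveragingEMLLinearised (combMean)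
open Literature.MathematicalPhysics.QuantumFieldTheory.Balaban1983to89.B12RegularSpaces111
open Literature.MathematicalPhysics.QuantumFieldTheory.Balaban1983to89.B12RegularSpaces111SpecialUnitary (suModel mem_suModel_G mem_suModel_gc suModel_norm_le)
open Literature.MathematicalPhysics.QuantumFieldTheory.Balaban1983to89.MatrixLog (mlog)
open Literature.MathematicalPhysics.QuantumFieldTheory.Balaban1983to89.B7Prop1Explicit (U1 mem_U1)
open Literature.MathematicalPhysics.QuantumFieldTheory.Balaban1983to89.B10Eq27TorusAxialLog (axialT)
open Literature.MathematicalPhysics.QuantumFieldTheory.Balaban1983to89.T4TermwiseBCH (norm_units_conj_le)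
open Literature.MathematicalPhysics.QuantumFieldTheory.Balaban1983to89.Node00 (MatA)
open Literature.MathematicalPhysics.QuantumFieldTheory.Balaban1983to89.Node00.Sect2 (regionOfSet domSys domSites frameI Residual)
open Literature.MathematicalPhysics.QuantumFieldTheory.Balaban1983to89.Node00.W1
open YMDAG.N18.AvgPotential (twoBlocks_subset_bonds_preimage)
open YMDAG.N18.TwoRunCubes (ladder domSites_pairOfRecord_eq_preimage)

section Record

variable (F : T4Family) (N : ℕ) [NeZero N] (M k : ℕ)

variable {F N M k}

/-- ★★★ **THE COMB GENERATOR OF RECORD WITH ITS SHARP C¹ LETTER.**  (3a)'s `l` (same exhibited formula) with letters (0)–(4) of `comb_letters_TΦOfRecord` and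
(5♯): for every direction pair `q = (x, ν, μ)` of run A's frame over `Y`, `‖∇^ξ_{U_A,ν}(Pot(⟨·,μ⟩) − i∇^ξ_{U_A,μ} l)(x)‖ ≤ S₁`,
`S₁ = ξ⁻¹·[(η∕ξ)·L·(69ℓtα₁B + L(ηα₁B + 2tα₁B)) + 2(R∕ξ + (η∕ξ)69ℓ²tα₁B)]` — (4d) at the coarse direction pair `(x̂, ν, μ)` on the frame cut-off `A′_X`, with run B's (ii)
`|∇^η_U A′| < α₁B` on the pair blocks' direction pairs and FILE D's `Ū(U) ∈ SU(N)` at the frame bond `⟨x, ν⟩`.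
[cite: Balaban1985Averaging, Prop. 3 (122)-(126) p.36, (62)-(63) p.28; Balaban1987RG1, (0.4) p.253, (0.24)-(0.25) p.257, (1.10)-(1.16) p.262] -/
theorem comb_letters_C1_TΦOfRecord (Rz : Residual (F.P (k + 1)) (MatA N)) (j : ℕ) (Y : (domSys (F.P k) M j).Dom)
    [DecidablePred (· ∈ (frameI Rz M (j + 1) (domSites (F.P (k + 1)) M (j + 1) (pairOfRecord F M k ⟨j, Y⟩).2)).X.bonds)] {cB : StepConsts} {α₀B α₁B : ℝ}
    {Φ : FieldPair (F.P (k + 1)) 0 (MatA N)ˣ (MatA N)} {U : PBond (F.P (k + 1)) 0 → (MatA N)ˣ} {A' : PBond (F.P (k + 1)) 0 → MatA N}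
    (hcBξ : cB.ξ = (F.P (k + 1)).eta (j + 1))
    (hf : Factors cB Φ.U U A')
    (hI : CondI (suModel N) (frameI Rz M (j + 1) (domSites (F.P (k + 1)) M (j + 1) (pairOfRecord F M k ⟨j, Y⟩).2)) cB α₀B U)
    (hII : CondII (suModel N) (frameI Rz M (j + 1) (domSites (F.P (k + 1)) M (j + 1) (pairOfRecord F M k ⟨j, Y⟩).2)).X cB α₁B U A')
    (hα0 : 0 ≤ α₀B) (hα1 : 0 ≤ α₁B) (hξ₁ : (F.P (k + 1)).eta (j + 1) * α₁B ≤ 1 / 4) {t : ℝ}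
    (hRt : (((((F.P (k + 1)).d + 4) * (F.P (k + 1)).L : ℕ) : ℝ) / 2) * (α₀B * (F.P (k + 1)).eta (j + 1) ^ 2) ≤ t)
    (hℓ : 136 * (((((F.P (k + 1)).d + 2) * (F.P (k + 1)).L : ℕ) : ℝ)) *
      ((2 * ((F.P (k + 1)).eta (j + 1) * α₁B) + t + 2 * ((F.P (k + 1)).eta (j + 1) * α₁B) * t) + t) ≤ 1)
    (hUA1 : ∀ b ∈ (frameI (Residual.unit (F.P k) (MatA N)) M j (domSites (F.P k) M j Y)).X.bonds,
      fieldShift (ladder F k) (avgUnits U) b ∈ U1 (MatA N)) :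
    let X := (frameI Rz M (j + 1) (domSites (F.P (k + 1)) M (j + 1) (pairOfRecord F M k ⟨j, Y⟩).2)).X
    let AX : PBond (F.P (k + 1)) 0 → MatA N := fun b => if b ∈ X.bonds then A' b else 0
    let UA : PBond (F.P k) 0 → (MatA N)ˣ := fieldShift (ladder F k) (avgUnits U)
    let R : ℝ := (4 * (34 * (((((F.P (k + 1)).d + 2) * (F.P (k + 1)).L : ℕ) : ℝ)) * ((2 * ((F.P (k + 1)).eta (j + 1) * α₁B) + t + 2 * ((F.P (k + 1)).eta (j + 1) * α₁B) * t) + t)) ^ 2 +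
        578 * (((((F.P (k + 1)).d + 2) * (F.P (k + 1)).L : ℕ) : ℝ)) ^ 2 * ((2 * ((F.P (k + 1)).eta (j + 1) * α₁B) + t + 2 * ((F.P (k + 1)).eta (j + 1) * α₁B) * t) + t) * t +
        660 * (((((F.P (k + 1)).d + 2) * (F.P (k + 1)).L : ℕ) : ℝ)) ^ 2 * ((2 * ((F.P (k + 1)).eta (j + 1) * α₁B) + t + 2 * ((F.P (k + 1)).eta (j + 1) * α₁B) * t) ^ 2 + t ^ 2) +
        3 * (((((F.P (k + 1)).d + 2) * (F.P (k + 1)).L : ℕ) : ℝ)) * (2 * ((F.P (k + 1)).eta (j + 1) * α₁B) * t) +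
        3 * (((((F.P (k + 1)).d + 2) * (F.P (k + 1)).L : ℕ) : ℝ)) * ((F.P (k + 1)).eta (j + 1) * α₁B) ^ 2)
    let S₀ : ℝ := (F.P (k + 1)).eta (j + 1) / (F.P k).eta j * (((F.P (k + 1)).L : ℝ) * α₁B) + R / (F.P k).eta j +
      (F.P (k + 1)).eta (j + 1) / (F.P k).eta j * (69 * (((((F.P (k + 1)).d + 2) * (F.P (k + 1)).L : ℕ) : ℝ)) ^ 2 * t * α₁B)
    let S₁ : ℝ := ((F.P k).eta j)⁻¹ * ((F.P (k + 1)).eta (j + 1) / (F.P k).eta j * ((F.P (k + 1)).L : ℝ) *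
        (69 * (((((F.P (k + 1)).d + 2) * (F.P (k + 1)).L : ℕ) : ℝ)) * t * α₁B + ((F.P (k + 1)).L : ℝ) * ((F.P (k + 1)).eta (j + 1) * α₁B + 2 * t * α₁B)) +
      2 * (R / (F.P k).eta j + (F.P (k + 1)).eta (j + 1) / (F.P k).eta j * (69 * (((((F.P (k + 1)).d + 2) * (F.P (k + 1)).L : ℕ) : ℝ)) ^ 2 * t * α₁B)))
    ∃ l : Site (F.P k) 0 → MatA N,
    (∀ x, l x = (I * ((F.P (k + 1)).eta (j + 1) : ℂ)) • combMean (adJ (axialT U (emb (siteShift (ladder F k) x))) AX) (siteShift (ladder F k) x)) ∧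
    (∀ x, Matrix.trace (l x) = 0) ∧
    (∀ x ∈ domSites (F.P k) M j Y, ‖l x‖ ≤ (F.P (k + 1)).eta (j + 1) * ((((((F.P (k + 1)).d + 2) * (F.P (k + 1)).L : ℕ) : ℝ)) * α₁B)) ∧
    (∀ (x : Site (F.P k) 0) (μ : Fin (F.P k).d), x ∈ domSites (F.P k) M j Y → x.shift μ ∈ domSites (F.P k) M j Y →
      ‖nabla ((F.P k).eta j) UA μ l x‖ ≤ 2 * ((F.P (k + 1)).eta (j + 1) * ((((((F.P (k + 1)).d + 2) * (F.P (k + 1)).L : ℕ) : ℝ)) * α₁B)) / (F.P k).eta j) ∧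
    (∀ b ∈ (frameI (Residual.unit (F.P k) (MatA N)) M j (domSites (F.P k) M j Y)).X.bonds,
      ‖(I * ((F.P k).eta j : ℂ))⁻¹ • mlog ((((TΦOfRecord F N k Φ).U b : (MatA N)ˣ) : MatA N) * (((UA b)⁻¹ : (MatA N)ˣ) : MatA N)) -
        I • nabla ((F.P k).eta j) UA b.dir l b.src‖ ≤ S₀) ∧
    (∀ q ∈ (frameI (Residual.unit (F.P k) (MatA N)) M j (domSites (F.P k) M j Y)).X.dpairs,
      ‖nabla ((F.P k).eta j) UA q.2.1
          (fun y => (I * ((F.P k).eta j : ℂ))⁻¹ • mlog ((((TΦOfRecord F N k Φ).U ⟨y, q.2.2⟩ : (MatA N)ˣ) : MatA N) * (((UA ⟨y, q.2.2⟩)⁻¹ : (MatA N)ˣ) : MatA N)) -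
            I • nabla ((F.P k).eta j) UA q.2.2 l y) q.1‖ ≤ S₁) := by
  intro X AX UA R S₀ S₁
  set η : ℝ := (F.P (k + 1)).eta (j + 1) with hηdef
  set ξ : ℝ := (F.P k).eta j with hξdef
  set ℓ : ℝ := (((((F.P (k + 1)).d + 2) * (F.P (k + 1)).L : ℕ) : ℝ)) with hℓdef
  have hη : 0 < η := pow_pos (inv_pos.mpr (Nat.cast_pos.mpr (F.P (k + 1)).L_pos)) _
  have hξ : 0 < ξ := pow_pos (inv_pos.mpr (Nat.cast_pos.mpr (F.P k).L_pos)) _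
  have hj1 : 0 + 1 ≤ (F.P (k + 1)).m + (F.P (k + 1)).K := by simp only [T4Family.P_m, T4Family.P_K]; omega
  have hj2 : 0 + 2 ≤ (F.P (k + 1)).m + (F.P (k + 1)).K := by simp only [T4Family.P_m, T4Family.P_K]; have := F.hm; omega
  have hRt2 : (((((F.P (k + 1)).d + 2) * (F.P (k + 1)).L : ℕ) : ℝ) / 2) * (α₀B * η ^ 2) ≤ t := by
    refine le_trans (mul_le_mul_of_nonneg_right ?_ (by positivity)) hRt
    gcongr; omega
  -- (3a): the comb generator of record and its C⁰ letters
  obtain ⟨l, hl, hltr, hl0, hl1, hS0, -⟩ := comb_letters_TΦOfRecord (M := M) (k := k) Rz j Y (Φ := Φ) hcBξ hf hI hII hα0 hα1 hξ₁ hRt2 hℓ hUA1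
  refine ⟨l, hl, hltr, hl0, hl1, hS0, fun q hq => ?_⟩
  -- run B's region is the block preimage of `domSites Y`
  have hX : X = regionOfSet (F.P (k + 1)) ((fun x => (siteShift (ladder F k)).symm (blockOf x)) ⁻¹' domSites (F.P k) M j Y) := by
    show regionOfSet (F.P (k + 1)) (domSites (F.P (k + 1)) M (j + 1) (pairOfRecord F M k ⟨j, Y⟩).2) = _
    rw [domSites_pairOfRecord_eq_preimage]
  have hAXle : ∀ b, ‖AX b‖ ≤ α₁B := fun b => by
    by_cases hb : b ∈ X.bonds
    · simp only [AX, if_pos hb]; exact (hII.norm_lt b hb).le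
    · simp only [AX, if_neg hb, norm_zero]; exact hα1
  have hAXeq : ∀ b ∈ X.bonds, AX b = A' b := fun b hb => by simp only [AX, if_pos hb]
  obtain ⟨h0, hν, hμ, hνμ⟩ := hq
  set x : Site (F.P k) 0 := q.1 with hx
  set ν : Fin 4 := q.2.1 with hν'
  set μ : Fin 4 := q.2.2 with hμ'
  set xh : Site (F.P (k + 1)) 1 := siteShift (ladder F k) x with hxh
  -- the pair blocks of `(x̂, ν, μ)` lie over `{x, x+e_ν, x+e_μ, x+e_ν+e_μ} ⊂ domSites Y`
  have hsite : ∀ z : Site (F.P (k + 1)) 0,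
      (blockOf z = xh ∨ blockOf z = xh.shift μ ∨ blockOf z = xh.shift ν ∨ blockOf z = (xh.shift μ).shift ν) →
      (siteShift (ladder F k)).symm (blockOf z) ∈ domSites (F.P k) M j Y := fun z hz => by
    rcases hz with h | h | h | h
    · rw [h, hxh, Equiv.symm_apply_apply]; exact h0
    · rw [h, hxh, ← siteShift_shift, Equiv.symm_apply_apply]; exact hμ
    · rw [h, hxh, ← siteShift_shift, Equiv.symm_apply_apply]; exact hν
    · rw [h, hxh, ← siteShift_shift, ← siteShift_shift, Equiv.symm_apply_apply, Site.shift_comm]; exact hνμ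
  have hbond : ∀ b : PBond (F.P (k + 1)) 0,
      (blockOf b.src = xh ∨ blockOf b.src = xh.shift μ ∨ blockOf b.src = xh.shift ν ∨ blockOf b.src = (xh.shift μ).shift ν) →
      (blockOf b.tgt = xh ∨ blockOf b.tgt = xh.shift μ ∨ blockOf b.tgt = xh.shift ν ∨ blockOf b.tgt = (xh.shift μ).shift ν) → b ∈ X.bonds :=
    fun b h1 h2 => by rw [hX]; exact ⟨hsite _ h1, hsite _ h2⟩
  have hplaqX : ∀ p : Plaq (F.P (k + 1)) 0,
      (blockOf p.src = xh ∨ blockOf p.src = xh.shift μ ∨ blockOf p.src = xh.shift ν ∨ blockOf p.src = (xh.shift μ).shift ν) →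
      (blockOf (p.src.shift p.μ) = xh ∨ blockOf (p.src.shift p.μ) = xh.shift μ ∨ blockOf (p.src.shift p.μ) = xh.shift ν ∨
        blockOf (p.src.shift p.μ) = (xh.shift μ).shift ν) →
      (blockOf (p.src.shift p.ν) = xh ∨ blockOf (p.src.shift p.ν) = xh.shift μ ∨ blockOf (p.src.shift p.ν) = xh.shift ν ∨
        blockOf (p.src.shift p.ν) = (xh.shift μ).shift ν) →
      (blockOf ((p.src.shift p.μ).shift p.ν) = xh ∨ blockOf ((p.src.shift p.μ).shift p.ν) = xh.shift μ ∨
        blockOf ((p.src.shift p.μ).shift p.ν) = xh.shift ν ∨ blockOf ((p.src.shift p.μ).shift p.ν) = (xh.shift μ).shift ν) → p ∈ X.plaqs :=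
    fun p h1 h2 h3 h4 => by rw [hX]; exact ⟨hsite _ h1, hsite _ h2, hsite _ h3, hsite _ h4⟩
  -- (4d) at `(x̂, ν, μ)` on the frame cut-off `A′_X`
  have h4d := norm_nabla_transported_comb_le hj1 hj2 xh μ ν (Uc := Φ.U) (U := U) (A := AX) (η := η) (ξ := ξ) (a := α₁B) (a₁ := α₁B)
    (α := α₀B * η ^ 2) (t := t) hη hξ hα1 hα1 (by positivity)
    (fun b h1 h2 => by rw [hAXeq b (hbond b h1 h2), ← hcBξ]; exact hf b) (fun b _ _ => hAXle b) (by linarith)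
    (fun b h1 h2 => by
      have hG := hI.gValued b (hbond b h1 h2)
      exact mem_U1.mpr ⟨suModel_norm_le _ hG, suModel_norm_le _ ((suModel N).G.inv_mem hG)⟩)
    (fun p h1 h2 h3 h4 => by rw [← hcBξ]; exact (hI.plaq_lt p (hplaqX p h1 h2 h3 h4)).le)
    (fun z κ hz hzν hzκ hzνκ => by
      -- `∇^η_U A′_X = ∇^η_U A′` at a direction pair of the region; (ii)
      have hq' : (z, ν, κ) ∈ X.dpairs := by rw [hX]; exact ⟨hsite _ hz, hsite _ hzν, hsite _ hzκ, hsite _ hzνκ⟩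
      have hb1 : (⟨z, κ⟩ : PBond (F.P (k + 1)) 0) ∈ X.bonds := by rw [hX]; exact ⟨hsite _ hz, hsite _ hzκ⟩
      have hb2 : (⟨z.shift ν, κ⟩ : PBond (F.P (k + 1)) 0) ∈ X.bonds := by rw [hX]; exact ⟨hsite _ hzν, hsite _ hzνκ⟩
      rw [nabla_congr (U := U) (V := U) (F := fun w => AX ⟨w, κ⟩) (G := fun w => A' ⟨w, κ⟩) rfl (hAXeq _ hb1) (hAXeq _ hb2), ← hcBξ]
      exact (hII.nabla_lt _ hq').le)
    hRt hℓ (hUA1 ⟨x, ν⟩ ⟨h0, hν⟩)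
  -- the dictionary: the function inside `∇^ξ_{U_A,ν}` is `y ↦ W(ŷ, μ)`
  set G : Site (F.P (k + 1)) 1 → MatA N := fun yh =>
    (I * (ξ : ℂ))⁻¹ • mlog (((avgUnits Φ.U ⟨yh, μ⟩ : (MatA N)ˣ) : MatA N) * (((avgUnits U ⟨yh, μ⟩)⁻¹ : (MatA N)ˣ) : MatA N)) +
      ((η / ξ : ℝ) : ℂ) • (((avgUnits U ⟨yh, μ⟩ : (MatA N)ˣ) : MatA N) * combMean (adJ (axialT U (emb (yh.shift μ))) AX) (yh.shift μ) *
        (((avgUnits U ⟨yh, μ⟩)⁻¹ : (MatA N)ˣ) : MatA N) - combMean (adJ (axialT U (emb yh)) AX) yh) with hG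
  have hfun : (fun y => (I * (ξ : ℂ))⁻¹ • mlog ((((TΦOfRecord F N k Φ).U ⟨y, μ⟩ : (MatA N)ˣ) : MatA N) * (((UA ⟨y, μ⟩)⁻¹ : (MatA N)ˣ) : MatA N)) -
        I • nabla ξ UA μ l y) = fun y => G (siteShift (ladder F k) y) := by
    funext y
    have hTU : (TΦOfRecord F N k Φ).U ⟨y, μ⟩ = avgUnits Φ.U ⟨siteShift (ladder F k) y, μ⟩ := by rw [TΦOfRecord_U]; rfl
    have hUAb : UA ⟨y, μ⟩ = avgUnits U ⟨siteShift (ladder F k) y, μ⟩ := rfl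
    have hnab : I • nabla ξ UA μ l y =
        -(((η / ξ : ℝ) : ℂ) • (((avgUnits U ⟨siteShift (ladder F k) y, μ⟩ : (MatA N)ˣ) : MatA N) *
          combMean (adJ (axialT U (emb ((siteShift (ladder F k) y).shift μ))) AX) ((siteShift (ladder F k) y).shift μ) *
          (((avgUnits U ⟨siteShift (ladder F k) y, μ⟩)⁻¹ : (MatA N)ˣ) : MatA N) - combMean (adJ (axialT U (emb (siteShift (ladder F k) y))) AX) (siteShift (ladder F k) y))) := by
      unfold nabla
      rw [hl (y.shift μ), hl y, hUAb, siteShift_shift]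
      rw [mul_smul_comm, smul_mul_assoc, ← smul_sub, smul_smul, smul_smul, ← neg_smul]
      congr 1
      have hI2 : I * I = -1 := Complex.I_mul_I
      push_cast
      rw [div_eq_mul_inv]
      linear_combination ((η : ℂ) * (ξ : ℂ)⁻¹) * hI2
    rw [hG, hTU, hUAb, hnab, sub_neg_eq_add]
  rw [hfun, show UA = fieldShift (ladder F k) (avgUnits U) from rfl, nabla_fieldShift_comp F N k ξ (avgUnits U) ν G x, hG]
  exact h4d

end Record

end YMDAG.N18.TransportOfRecord

end
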